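import Literature.Geometry.Lorentzian.KerrDeSitterRadialAmplitude
import HarnessLib

/-!
# Half-integer spin `|s| = 1/2` on the real axis: the first-order (Teukolsky–Starobinsky / Dirac)
# structure of the Kerr–de Sitter radial equation and the coercive energy identity —
# Casals–Teixeira da Costa's Theorem 3.10, fermionic real-axis clause, in its domain of validity

Definitions with bodies + theorems (NO named facts). Companion of
`KerrDeSitterRealFrequencyModes.lean` (`s = 0`) and `KerrDeSitterRadialAmplitude.lean`.

Sources read verbatim (held texts; page/line of the materialised pages):
* [CasalsTeixeiradacosta2022] M. Casals, R. Teixeira da Costa, Commun. Math. Phys. 394 (2022)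
  797–832, arXiv:2105.13329: Theorem 3.10 (v1: 3.11), second bullet (p. 16 l. 85 – p. 17 l. 3):
  "`ω ∈ ℝ`, `λ̄ ∈ ℝ` and, if `|s| ≠ 1/2, 3/2`, additionally `m = 0` or `ω/m ∉ (…)`"; its whole
  printed proof for half-integer `s` (p. 17 l. 56): "By the same method [the Teukolsky–Starobinsky
  identities], one may deduce that if `|s| ≤ 2` is half-integer, the energy identity implies that in
  fact `u ≡ 0` holds independently of `ω`."
* [Costa2019] R. Teixeira da Costa, Commun. Math. Phys. 378 (2020) 705–781, arXiv:1910.02854: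
  Proposition 2.21 (p. 17 l. 30–62), the half-integer energy identity for an outgoing solution,
  `(2ω)^{4s}(2Mr₊/(r₊−r₋))Π_j[4|ξ|²+(s−j)²]|a_{𝓘⁺}|² + (2ω)^{2s−1} ℭ_s |a_{𝓗⁺}|² = 0` — coercive
  exactly when the radial Teukolsky–Starobinsky constant `ℭ_s ≥ 0`; Remark 2.12 (p. 12 l. 61–65):
  for `λ` an ANGULAR eigenvalue `ℭ_{1/2} = −𝔅_{1/2} ≥ 0`.
* [WuYan2004] S.-Q. Wu, M.-L. Yan, Phys. Rev. D 69 (2004) 044019, arXiv:gr-qc/0303076, Appendix A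
  (p. 14 l. 7–35): the Kerr–de Sitter radial operators `𝒟_n = ∂_r − iΞK/Δ_r + nΔ_r'/Δ_r`,
  `𝒟_n† = ∂_r + iΞK/Δ_r + nΔ_r'/Δ_r`, the radial equations (A3) (spin `+s`, for `Δ_r^s R_s`) and
  (A4) (spin `−s`), the Teukolsky–Starobinsky identities (A5) and the constants (A6), first line:
  `|C_{1/2}|² = λ_{1/2}` (their separation constant `λ`).

## What is here

* VOCABULARY (definitions with bodies): `tsLambdaWY` (Wu–Yan's separation constant `λ_{|s|}` of
  (A3) as a function of CTdC's `λ̄`; at spin `+s` it IS the tree's `λ` — `tsLambdaWY_lambdaBar` —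
  and at spin `−s` it is `λ + 2s(1−α)` — `tsLambdaWY_lambdaBar_neg`), `tsRadialConstantHalf`
  (`ℭ_{1/2}(λ̄) := |C_{1/2}|² = λ_{1/2}`), and the predicate `FermionicTSCoercive M a Λ s ω m λ` :=
  "`2|s| = 1 ∧ 0 ≤ Re ℭ_{1/2}(λ̄)`", `λ̄ = lambdaBar λ` (`fermionicTSCoercive_half_iff`: at `s = 1/2`
  it reads `0 ≤ Re λ`; `fermionicTSCoercive_neg_half_iff`: at `s = −1/2`, `0 ≤ Re λ + (1 − α)`).
  Only `|s| = 1/2` is given a coercivity clause: the `|s| = 3/2` constant (Wu–Yan (A6), third line)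
  is printed without proof and is not needed by any theorem of the tree.
* `s = +1/2` — THE FIRST-ORDER PAIR. With `P := Δ_r R' + (Δ_r'/2 + iΞK)R`
  (`= Δ_r^{1/2}𝒟₀†(Δ_r^{1/2}R)`, Wu–Yan's operator at `n = 0`), the tree's spin-`1/2` radial
  Teukolsky equation (`IsRadialTeukolskySolution … (1/2) …`, STU (3.7) = Hatsuda (2.13)) says
  exactly `P' = (iΞK/Δ_r)P + λR` (`hasDerivAt_tsPartner_half`; uses `Δ_r''/2 = (1−α) − 2Λr²`,
  `K' = 2ωr`). For REAL `ω` and REAL `λ` the form `Q := λ·Δ_r|R|² − |P|²` is therefore CONSTANT on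
  `(r₊, r_c)` (this is [Costa2019] Prop. 2.21 at `s = 1/2`, transplanted to the two horizons of
  Kerr–de Sitter; no `2s`-th order Teukolsky–Starobinsky machinery is needed at `|s| = 1/2`). Its
  horizon values for a solution ingoing at `𝓗⁺` (`R = (r−r₊)^{−1/2−B(r₊)}f`) and outgoing at `𝓗⁺_c`
  (`R = (r_c−r)^{B(r_c)}g`) are `λ·Δ_r'(r₊)|f(r₊)|²` and `−|Δ_r'(r_c)/2 + 2iΞK(r_c)|²·|g(r_c)|²`.
  `radial_half_real_eq_zero_of_coercive` — THE THEOREM at `s = +1/2`: subextremal `(M,a,Λ)`,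
  `Im ω = 0`, `Im λ = 0`, `0 ≤ Re λ` (`= ℭ_{1/2}(λ̄) ≥ 0`), `R` a radial Teukolsky solution ingoing at
  `𝓗⁺` and outgoing at `𝓗⁺_c` ⟹ `R ≡ 0` on `(r₊, r_c)` (both horizon values vanish, so `g(r_c) = 0`,
  and `radial_eq_zero_of_cosmoAmplitude_eq_zero` finishes). NO condition on `ω ∈ ℝ` (also `ω = 0`),
  on `m`, on the rotation `a`, and no superradiant-window condition.
* `s = −1/2` — the mirror pair `P₋ := R' − (iΞK/Δ_r)R` (`= 𝒟₀R`), equation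
  `Δ_r P₋' + (Δ_r'/2 + iΞK)P₋ = (λ + (1−α))R` (`hasDerivAt_tsPartner_negHalf`), conserved form
  `Q₋ := (λ + (1−α))|R|² − Δ_r|P₋|²` with horizon values `−Δ_r'(r₊)|1/2 − 2B(r₊)|²|f(r₊)|²` and
  `(λ + (1−α))|g(r_c)|²`; `radial_negHalf_real_eq_zero_of_coercive` — THE THEOREM at `s = −1/2`
  under `0 ≤ Re λ + (1 − α)` (`= ℭ_{1/2}(λ̄) ≥ 0` at spin `−1/2`): `f(r₊) = 0` and
  `radial_eq_zero_of_eventAmplitude_eq_zero` finishes.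
* `radial_real_eq_zero_of_fermionicTSCoercive` — both signs packaged with the clause
  `FermionicTSCoercive` and CTdC's binder `Im λ̄ = 0`.

What is NOT here, and why. For `ℭ_{1/2}(λ̄) < 0` the identity reads
`|λ|Δ_r'(r₊)|f(r₊)|² = |Δ_r'(r_c)/2 + 2iΞK(r_c)|²|g(r_c)|²` and proves nothing; the printed clause
"any real `λ̄`" is in fact FALSE there (cell pub-kds, venture `Summits/Ventures/KdS`, pre-registration
P-014: a certified real-frequency, real-`λ̄` generic-boundary solution at `s = 1/2` with
`ℭ_{1/2}(λ̄) < 0`). Genuine ANGULAR eigenvalues have `ℭ_{1/2} = λ_{1/2} ≥ 0` ([Costa2019] Remark 2.12;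
the square of the Chandrasekhar–Page separation constant), so the physical statement (CTdC Def. 3.4
mode solutions, their Theorem 2) is untouched. `|s| = 3/2` is not treated.
-/

noncomputable section

open Complex Set Filter Topology

open scoped ComplexConjugate

namespace Literature.Geometry.Lorentzian.KerrDeSitter

/-! ### Vocabulary: Wu–Yan's `λ_{|s|}`, the radial TS constant at `|s| = 1/2`, the coercivity clause -/

/-- **Wu–Yan's separation constant `λ_{|s|}` as a function of CTdC's `λ̄`.** The radial equation
(A3) for `Δ_r^s R_s` is the tree's `IsRadialTeukolskySolution … s … λ` at spin `+s` with
`λ = λ_{s}` (same zeroth-order coefficient `… + 2s(1−α) − λ`), and CTdC's `λ̄` is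
`lambdaBar λ = λ − s(1−α) + Ξ²(2amω − a²ω²)`; hence `λ_{|s|}(λ̄) = λ̄ + |s|(1−α) − Ξ²(2amω − a²ω²)`.
[cite: WuYan2004, Appendix A, (A3)] -/
def tsLambdaWY (a Λ sAbs : ℝ) (ω : ℂ) (m : ℝ) (lamBar : ℂ) : ℂ :=
  lamBar + ((sAbs * (1 - alpha a Λ) : ℝ) : ℂ) -
    (xi a Λ : ℂ) ^ 2 * (2 * (a : ℂ) * (m : ℂ) * ω - (a : ℂ) ^ 2 * ω ^ 2)

/-- At spin `+s` Wu–Yan's `λ_s(λ̄)` is the tree's separation constant `λ`.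
[cite: WuYan2004, Appendix A, (A3)] -/
@[simp] theorem tsLambdaWY_lambdaBar (a Λ s : ℝ) (ω : ℂ) (m : ℝ) (lam : ℂ) :
    tsLambdaWY a Λ s ω m (lambdaBar a Λ s ω m lam) = lam := by
  simp only [tsLambdaWY, lambdaBar]
  ring

/-- At spin `−s` (same `λ̄`, CTdC's `λ̄` being spin-flip invariant) Wu–Yan's `λ_s(λ̄)` is the tree's
`λ` shifted by `2s(1−α)` ((A4) is the tree's equation at spin `−s` with `λ = λ_s − 2s(1−α)`).
[cite: WuYan2004, Appendix A, (A4)] -/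
theorem tsLambdaWY_lambdaBar_neg (a Λ s : ℝ) (ω : ℂ) (m : ℝ) (lam : ℂ) :
    tsLambdaWY a Λ s ω m (lambdaBar a Λ (-s) ω m lam) =
      lam + ((2 * s * (1 - alpha a Λ) : ℝ) : ℂ) := by
  simp only [tsLambdaWY, lambdaBar]
  push_cast
  ring

/-- **The radial Teukolsky–Starobinsky constant of Kerr–de Sitter at `|s| = 1/2`**, as a function of
CTdC's `λ̄`: `ℭ_{1/2}(λ̄) := |C_{1/2}|² = λ_{1/2} = λ̄ + (1−α)/2 + Ξ²aω(aω − 2m)` (Wu–Yan (A6), first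
line; for `Λ = 0` this is [Costa2019] Remark 2.12's `ℭ_{1/2}`). For real `ω`, `λ̄` it is real; it is
NOT a priori non-negative unless `λ̄` is an angular eigenvalue. [cite: WuYan2004, Appendix A, (A6)] -/
def tsRadialConstantHalf (a Λ : ℝ) (ω : ℂ) (m : ℝ) (lamBar : ℂ) : ℂ :=
  tsLambdaWY a Λ (1 / 2) ω m lamBar

/-- **The Teukolsky–Starobinsky coercivity clause for the fermionic real-axis case, `|s| = 1/2`**:
`2|s| = 1` and `Re ℭ_{1/2}(λ̄) ≥ 0`, where `λ̄ = lambdaBar λ` is CTdC's separation constant of the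
radial function at hand — the condition under which the half-integer energy identity ([Costa2019]
Prop. 2.21; "by the same method" on Kerr–de Sitter, [CasalsTeixeiradacosta2022] p. 17) is coercive at
`|s| = 1/2`. (`M` is a dummy argument kept for a uniform signature with the other clauses of
Theorem 3.10.) [cite: Costa2019, Proposition 2.21 and Remark 2.12] -/
def FermionicTSCoercive (_M a Λ s : ℝ) (ω : ℂ) (m : ℝ) (lam : ℂ) : Prop :=
  2 * |s| = 1 ∧ 0 ≤ (tsRadialConstantHalf a Λ ω m (lambdaBar a Λ s ω m lam)).re

/-- The coercivity clause implies the printed spin condition `2|s| ∈ {1, 3}` of Theorem 3.10's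
fermionic escape. [cite: CasalsTeixeiradacosta2022, Theorem 3.10] -/
theorem FermionicTSCoercive.two_abs_spin {M a Λ s : ℝ} {ω : ℂ} {m : ℝ} {lam : ℂ}
    (h : FermionicTSCoercive M a Λ s ω m lam) : ∃ k : ℤ, 2 * |s| = k ∧ (k = 1 ∨ k = 3) :=
  ⟨1, by exact_mod_cast h.1, Or.inl rfl⟩

/-- Under the clause, `s = 1/2` or `s = −1/2`. [cite: CasalsTeixeiradacosta2022, Theorem 3.10] -/
theorem FermionicTSCoercive.eq_half_or {M a Λ s : ℝ} {ω : ℂ} {m : ℝ} {lam : ℂ}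
    (h : FermionicTSCoercive M a Λ s ω m lam) : s = 1 / 2 ∨ s = -(1 / 2) := by
  have h1 := h.1
  rcases abs_choice s with hs | hs <;> rw [hs] at h1
  · left; linarith
  · right; linarith

/-- At `s = +1/2` the coercivity clause is `0 ≤ Re λ` (`ℭ_{1/2}(λ̄) = λ_{1/2} = λ`, the tree's own
separation constant). [cite: WuYan2004, Appendix A, (A6)] -/
theorem fermionicTSCoercive_half_iff (M a Λ : ℝ) (ω : ℂ) (m : ℝ) (lam : ℂ) :
    FermionicTSCoercive M a Λ (1 / 2) ω m lam ↔ 0 ≤ lam.re := by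
  have habs : |(1 / 2 : ℝ)| = 1 / 2 := abs_of_pos (by norm_num)
  constructor
  · rintro ⟨-, h⟩
    simpa [tsRadialConstantHalf] using h
  · intro h
    refine ⟨by rw [habs]; norm_num, ?_⟩
    simpa [tsRadialConstantHalf] using h

/-- At `s = −1/2` the coercivity clause is `0 ≤ Re λ + (1 − α)` (`ℭ_{1/2}(λ̄) = λ + (1 − α)` for
the tree's separation constant `λ` at spin `−1/2`). [cite: WuYan2004, Appendix A, (A6)] -/
theorem fermionicTSCoercive_neg_half_iff (M a Λ : ℝ) (ω : ℂ) (m : ℝ) (lam : ℂ) :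
    FermionicTSCoercive M a Λ (-(1 / 2)) ω m lam ↔ 0 ≤ lam.re + (1 - alpha a Λ) := by
  have habs : |(-(1 / 2) : ℝ)| = 1 / 2 := by rw [abs_neg]; exact abs_of_pos (by norm_num)
  have key : (tsRadialConstantHalf a Λ ω m (lambdaBar a Λ (-(1 / 2)) ω m lam)).re =
      lam.re + (1 - alpha a Λ) := by
    have h := tsLambdaWY_lambdaBar_neg a Λ (1 / 2) ω m lam
    simp only [tsRadialConstantHalf]
    rw [h]
    simp only [add_re, ofReal_re]
    ring
  constructor
  · rintro ⟨-, h⟩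
    rwa [key] at h
  · intro h
    refine ⟨by rw [habs]; norm_num, ?_⟩
    rwa [key]

/-! ### Elementary calculus of the radial data -/

/-- `Δ_r'' = 2(1 − Λa²/3) − 4Λr²` (derivative of `deltaDeriv`). [cite: Hatsuda2020, (2.13)] -/
theorem hasDerivAt_deltaDeriv (M a Λ r : ℝ) :
    HasDerivAt (fun r => deltaDeriv M a Λ r) (2 * (1 - Λ / 3 * a ^ 2) - 4 * Λ * r ^ 2) r := by
  have h1 : HasDerivAt (fun r : ℝ => 2 * r * (1 - Λ / 3 * r ^ 2))
      (2 * 1 * (1 - Λ / 3 * r ^ 2) + 2 * r * (-(Λ / 3 * (2 * r ^ 1 * 1)))) r := by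
    have ha : HasDerivAt (fun r : ℝ => 2 * r) (2 * 1) r := (hasDerivAt_id r).const_mul 2
    have hb : HasDerivAt (fun r : ℝ => 1 - Λ / 3 * r ^ 2) (-(Λ / 3 * (2 * r ^ 1 * 1))) r :=
      (((hasDerivAt_id r).pow 2).const_mul (Λ / 3)).const_sub 1
    exact ha.mul hb
  have h2 : HasDerivAt (fun r : ℝ => 2 * Λ / 3 * r * (r ^ 2 + a ^ 2))
      (2 * Λ / 3 * 1 * (r ^ 2 + a ^ 2) + 2 * Λ / 3 * r * (2 * r ^ 1 * 1)) r := by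
    have ha : HasDerivAt (fun r : ℝ => 2 * Λ / 3 * r) (2 * Λ / 3 * 1) r :=
      (hasDerivAt_id r).const_mul (2 * Λ / 3)
    have hb : HasDerivAt (fun r : ℝ => r ^ 2 + a ^ 2) (2 * r ^ 1 * 1) r := by
      simpa using ((hasDerivAt_id r).pow 2).add_const (a ^ 2)
    exact ha.mul hb
  have h := (h1.sub h2).sub_const (2 * M)
  refine h.congr_deriv ?_
  ring

/-- `K' = 2ωr`. [cite: Hatsuda2020, (2.14)] -/
theorem hasDerivAt_radialK (a : ℝ) (ω : ℂ) (m : ℝ) (r : ℝ) :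
    HasDerivAt (fun r => radialK a ω m r) (ω * (2 * (r : ℂ))) r := by
  have h1 : HasDerivAt (fun r : ℝ => (((r ^ 2 + a ^ 2 : ℝ)) : ℂ)) (((2 * r ^ 1 * 1 : ℝ)) : ℂ) r :=
    (((hasDerivAt_id r).pow 2).add_const (a ^ 2)).ofReal_comp
  have h := (h1.const_mul ω).sub_const (((a * m : ℝ)) : ℂ)
  refine h.congr_deriv ?_
  push_cast
  ring

/-- `K` is real at a real frequency. [cite: Hatsuda2020, (2.14)] -/
theorem im_radialK_of_real (a : ℝ) {ω : ℂ} (hω : ω.im = 0) (m r : ℝ) :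
    (radialK a ω m r).im = 0 := by
  simp only [radialK, sub_im, mul_im, ofReal_re, ofReal_im, hω, zero_mul, mul_zero, add_zero,
    sub_zero]

/-- `conj K = K` at a real frequency. [cite: Hatsuda2020, (2.14)] -/
theorem conj_radialK_of_real (a : ℝ) {ω : ℂ} (hω : ω.im = 0) (m r : ℝ) :
    conj (radialK a ω m r) = radialK a ω m r :=
  conj_eq_iff_im.2 (im_radialK_of_real a hω m r)

/-- `|u^z|² = u^{2Re z}` for a positive real base (private plumbing). [folklore] -/
private theorem normSq_ofReal_cpow {u : ℝ} (hu : 0 < u) (z : ℂ) :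
    normSq (((u : ℝ) : ℂ) ^ z) = u ^ (2 * z.re) := by
  rw [normSq_eq_norm_sq, norm_cpow_eq_rpow_re_of_pos hu, ← Real.rpow_natCast,
    ← Real.rpow_mul hu.le]
  congr 1
  push_cast
  ring

/-- The derivative of a branch `S = u^z·g` on an interval where it is known to be differentiable:
`S' = z u^{z−1} u' g + u^z g'` (uniqueness of derivatives; private plumbing, the computation inside
`tendsto_boundaryFlux_of_cpowBranch_of_re_eq_zero`). [folklore] -/
private theorem deriv_eq_of_cpowBranch {U J : Set ℝ} (hU : IsOpen U) (hJ : IsOpen J) (hJU : J ⊆ U)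
    {g : ℝ → ℂ} (hg : ContDiffOn ℝ ((⊤ : ℕ∞) : WithTop ℕ∞) g U)
    {u : ℝ → ℝ} {c : ℝ} (hu : ∀ x, HasDerivAt u c x) (hupos : ∀ x ∈ J, 0 < u x)
    (z : ℂ) {S S' : ℝ → ℂ} (hS : ∀ x ∈ J, HasDerivAt S (S' x) x)
    (hSg : ∀ x ∈ J, S x = ((u x : ℝ) : ℂ) ^ z * g x) :
    ∀ x ∈ J, S' x = z * ((u x : ℝ) : ℂ) ^ (z - 1) * (c : ℂ) * g x +
      ((u x : ℝ) : ℂ) ^ z * deriv g x := by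
  intro x hx
  have h0 : ((⊤ : ℕ∞) : WithTop ℕ∞) ≠ 0 := by simp
  have hgd : DifferentiableOn ℝ g U := hg.differentiableOn h0
  have hgx : HasDerivAt g (deriv g x) x :=
    ((hgd x (hJU hx)).differentiableAt (hU.mem_nhds (hJU hx))).hasDerivAt
  have hux : HasDerivAt (fun y => ((u y : ℝ) : ℂ)) (c : ℂ) x := (hu x).ofReal_comp
  have hslit : ((u x : ℝ) : ℂ) ∈ slitPlane := ofReal_mem_slitPlane.2 (hupos x hx)
  have hpow' : HasDerivAt ((fun w : ℂ => w ^ z) ∘ fun y => ((u y : ℝ) : ℂ))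
      (z * ((u x : ℝ) : ℂ) ^ (z - 1) * (c : ℂ)) x :=
    (hasStrictDerivAt_cpow_const (c := z) hslit).hasDerivAt.comp x hux
  have hpow : HasDerivAt (fun y => ((u y : ℝ) : ℂ) ^ z)
      (z * ((u x : ℝ) : ℂ) ^ (z - 1) * (c : ℂ)) x := by
    simpa only [Function.comp_def] using hpow'
  have hprod := hpow.mul hgx
  have heq : S =ᶠ[𝓝 x] fun y => ((u y : ℝ) : ℂ) ^ z * g y :=
    Filter.eventually_of_mem (hJ.mem_nhds hx) fun y hy => hSg y hy
  exact (hS x hx).unique (hprod.congr_of_eventuallyEq heq)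

/-! ### `s = +1/2`: the first-order pair `(R, P)` and its conservation law -/

/-- The spin-`+1/2` radial coefficient, regrouped: `V_{1/2} = (Ξ²K² − (i/2)ΞKΔ_r')/Δ_r + iΞK' +`
`Δ_r''/2 − λ` with `K' = 2ωr`, `Δ_r''/2 = (1 − Λa²/3) − 2Λr²`. [cite: SuzukiTakasugiUmetsu1998, (3.7)] -/
theorem radialPotential_half (M a Λ : ℝ) (ω : ℂ) (m : ℝ) (lam : ℂ) (r : ℝ) :
    radialPotential M a Λ (1 / 2) ω m lam r =
      ((xi a Λ : ℂ) ^ 2 * radialK a ω m r ^ 2 -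
            I / 2 * (xi a Λ : ℂ) * radialK a ω m r * (deltaDeriv M a Λ r : ℂ)) / (delta M a Λ r : ℂ) +
        I * (xi a Λ : ℂ) * (ω * (2 * (r : ℂ))) +
        (((2 * (1 - Λ / 3 * a ^ 2) - 4 * Λ * r ^ 2) / 2 : ℝ) : ℂ) - lam := by
  simp only [radialPotential, alpha]
  push_cast
  ring

/-- **The first-order structure at `s = +1/2`.** If `R` solves the spin-`1/2` radial Teukolsky
equation at `r` (pointwise: `ΔR'' + (3/2)Δ'R' + V_{1/2}R = 0` with `HasDerivAt` witnesses), then the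
Teukolsky–Starobinsky partner `P := Δ_r R' + (Δ_r'/2 + iΞK)R = Δ_r^{1/2}𝒟₀†(Δ_r^{1/2}R)` satisfies
`P' = (iΞK/Δ_r)·P + λ·R` at `r` (Wu–Yan's radial operators (A3)/(A5) at `2s = 1`).
[cite: WuYan2004, Appendix A, (A3) and (A5)] -/
theorem hasDerivAt_tsPartner_half {M a Λ : ℝ} {ω : ℂ} {m : ℝ} {lam : ℂ} {R R' R'' : ℝ → ℂ}
    {r : ℝ} (hΔ : delta M a Λ r ≠ 0) (h1 : HasDerivAt R (R' r) r) (h2 : HasDerivAt R' (R'' r) r)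
    (heq : (delta M a Λ r : ℂ) * R'' r + ((1 / 2 + 1 : ℝ) : ℂ) * (deltaDeriv M a Λ r : ℂ) * R' r +
      radialPotential M a Λ (1 / 2) ω m lam r * R r = 0) :
    HasDerivAt (fun y => (delta M a Λ y : ℂ) * R' y +
        (((deltaDeriv M a Λ y / 2 : ℝ) : ℂ) + I * (xi a Λ : ℂ) * radialK a ω m y) * R y)
      (I * (xi a Λ : ℂ) * radialK a ω m r / (delta M a Λ r : ℂ) *
          ((delta M a Λ r : ℂ) * R' r +
            (((deltaDeriv M a Λ r / 2 : ℝ) : ℂ) + I * (xi a Λ : ℂ) * radialK a ω m r) * R r) +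
        lam * R r) r := by
  have hΔc : (delta M a Λ r : ℂ) ≠ 0 := by exact_mod_cast hΔ
  have hΔd : HasDerivAt (fun y => (delta M a Λ y : ℂ)) ((deltaDeriv M a Λ r : ℝ) : ℂ) r :=
    (hasDerivAt_delta M a Λ r).ofReal_comp
  have hΔ'd : HasDerivAt (fun y => ((deltaDeriv M a Λ y / 2 : ℝ) : ℂ))
      ((((2 * (1 - Λ / 3 * a ^ 2) - 4 * Λ * r ^ 2) / 2 : ℝ)) : ℂ) r :=
    ((hasDerivAt_deltaDeriv M a Λ r).div_const 2).ofReal_comp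
  have hKd := hasDerivAt_radialK a ω m r
  have hprod := (hΔd.fun_mul h2).fun_add
    ((hΔ'd.fun_add (hKd.const_mul (I * (xi a Λ : ℂ)))).fun_mul h1)
  refine hprod.congr_deriv ?_
  have hR'' : (delta M a Λ r : ℂ) * R'' r =
      -(((1 / 2 + 1 : ℝ) : ℂ) * (deltaDeriv M a Λ r : ℂ) * R' r +
        radialPotential M a Λ (1 / 2) ω m lam r * R r) := by
    linear_combination heq
  rw [hR'', radialPotential_half]
  push_cast
  field_simp
  linear_combination (-6 * (xi a Λ : ℂ) ^ 2 * radialK a ω m r ^ 2 * R r) * I_sq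

/-- **CTdC Theorem 3.10, fermionic real-axis clause at `s = +1/2`, in its domain of validity
(`ℭ_{1/2}(λ̄) ≥ 0`) — PROVED.** On subextremal Kerr–de Sitter let `R` be a classical solution of the
spin-`1/2` radial Teukolsky equation on `(r₊, r_c)` with REAL frequency `ω` (any, including `ω = 0`)
and REAL separation constant `λ` with `Re λ ≥ 0`, ingoing at `𝓗⁺` and outgoing at `𝓗⁺_c` (generic
exponents). Then `R ≡ 0` on `(r₊, r_c)`. Mechanism ([Costa2019] Prop. 2.21 at `s = 1/2`, "by the
same method" [CasalsTeixeiradacosta2022] p. 17): with `P = Δ_r R' + (Δ_r'/2 + iΞK)R`,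
`Q = λΔ_r|R|² − |P|²` is constant (`hasDerivAt_tsPartner_half`, `K` and `λ` real); its limits are
`λΔ_r'(r₊)|f(r₊)|² ≥ 0` at `r₊` and `−|Δ_r'(r_c)/2 + 2iΞK(r_c)|²|g(r_c)|² ≤ 0` at `r_c` (Cauchy mean
value theorem with endpoint limits), so `g(r_c) = 0` and `radial_eq_zero_of_cosmoAmplitude_eq_zero`
concludes. No window / rotation / `m` condition is needed.
[cite: CasalsTeixeiradacosta2022, Theorem 3.10 (second bullet, |s| = 1/2) with Costa2019 Proposition 2.21] -/
theorem radial_half_real_eq_zero_of_coercive {M a Λ : ℝ} {ω : ℂ} {m : ℝ} {lam : ℂ}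
    (hsub : IsSubextremal M a Λ) (hω : ω.im = 0) (hlam : lam.im = 0) (hcoer : 0 ≤ lam.re)
    {R : ℝ → ℂ} (hR : IsRadialTeukolskySolution M a Λ (1 / 2) ω m lam R)
    (hin : IsIngoingAtEventHorizon M a Λ (1 / 2) ω m R) (hout : IsOutgoingAtCosmoHorizon M a Λ ω m R) :
    ∀ r ∈ Ioo (rPlus M a Λ) (rCosmo M a Λ), R r = 0 := by
  have hd1 := deltaDeriv_rPlus_pos hsub
  have hd2 := deltaDeriv_rCosmo_neg hsub
  have hsub' := hsub
  obtain ⟨hM, hΛ, h01, h12, hΔ1, hΔ2, -, hΔpos, -⟩ := hsub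
  have hξ : 0 < xi a Λ := xi_pos hΛ.le a
  have hr₁ : 0 < rPlus M a Λ := lt_of_le_of_lt (rMinus_nonneg M a Λ) h01
  have hr₂ : 0 < rCosmo M a Λ := hr₁.trans h12
  have hωim : 0 ≤ ω.im := le_of_eq hω.symm
  have h1top : (1 : WithTop ℕ∞) ≤ ((⊤ : ℕ∞) : WithTop ℕ∞) := by exact_mod_cast le_top
  have h0top : ((⊤ : ℕ∞) : WithTop ℕ∞) ≠ 0 := by simp
  obtain ⟨R', R'', hode⟩ := id hR
  obtain ⟨ε₁, hε₁, f, hf, hRf⟩ := hin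
  obtain ⟨ε₂, hε₂, g, hg, hRg⟩ := hout
  have hlamc : conj lam = lam := conj_eq_iff_im.2 hlam
  -- the partner `P` and the conserved form `Q = Re λ · Δ|R|² − |P|²`
  obtain ⟨P, hP⟩ : ∃ P : ℝ → ℂ, P = fun y => (delta M a Λ y : ℂ) * R' y +
      (((deltaDeriv M a Λ y / 2 : ℝ) : ℂ) + I * (xi a Λ : ℂ) * radialK a ω m y) * R y := ⟨_, rfl⟩
  obtain ⟨Q, hQ⟩ : ∃ Q : ℝ → ℝ, Q = fun y => lam.re * delta M a Λ y * normSq (R y) - normSq (P y) :=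
    ⟨_, rfl⟩
  have hQd : ∀ r ∈ Ioo (rPlus M a Λ) (rCosmo M a Λ), HasDerivAt Q 0 r := by
    intro r hr
    obtain ⟨h1, h2, heq⟩ := hode r hr
    have hΔne : delta M a Λ r ≠ 0 := (hΔpos r hr).ne'
    obtain ⟨c, hc⟩ : ∃ c : ℂ, c = I * (xi a Λ : ℂ) * radialK a ω m r / (delta M a Λ r : ℂ) :=
      ⟨_, rfl⟩
    have hPd : HasDerivAt P (c * P r + lam * R r) r := by
      rw [hP, hc]
      exact hasDerivAt_tsPartner_half (ω := ω) (m := m) (lam := lam) hΔne h1 h2 heq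
    have hcc : conj c = -c := by
      rw [hc]
      simp only [map_mul, map_div₀, conj_I, conj_ofReal, conj_radialK_of_real a hω m r]
      ring
    have hΔd : HasDerivAt (fun y => (delta M a Λ y : ℂ)) ((deltaDeriv M a Λ r : ℝ) : ℂ) r :=
      (hasDerivAt_delta M a Λ r).ofReal_comp
    have hRbar : HasDerivAt (fun y => conj (R y)) (conj (R' r)) r := by simpa using h1.star
    have hPbar : HasDerivAt (fun y => conj (P y)) (conj (c * P r + lam * R r)) r := by
      simpa using hPd.star
    -- the complex form `F = λ Δ R R̄ − P P̄`, with `Q = Re F`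
    have hF : HasDerivAt (fun y => lam * (delta M a Λ y : ℂ) * (R y * conj (R y)) - P y * conj (P y))
        (lam * ((deltaDeriv M a Λ r : ℝ) : ℂ) * (R r * conj (R r)) +
          lam * (delta M a Λ r : ℂ) * (R' r * conj (R r) + R r * conj (R' r)) -
          ((c * P r + lam * R r) * conj (P r) + P r * conj (c * P r + lam * R r))) r := by
      have hA := (hΔd.const_mul lam).fun_mul (h1.fun_mul hRbar)
      have hB := hPd.fun_mul hPbar
      exact (hA.fun_sub hB).congr_deriv (by ring)
    have hval : lam * ((deltaDeriv M a Λ r : ℝ) : ℂ) * (R r * conj (R r)) +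
          lam * (delta M a Λ r : ℂ) * (R' r * conj (R r) + R r * conj (R' r)) -
          ((c * P r + lam * R r) * conj (P r) + P r * conj (c * P r + lam * R r)) = 0 := by
      have hPr : P r = (delta M a Λ r : ℂ) * R' r +
          (((deltaDeriv M a Λ r / 2 : ℝ) : ℂ) + I * (xi a Λ : ℂ) * radialK a ω m r) * R r := by
        rw [hP]
      rw [map_add, map_mul, map_mul, hcc, hlamc, hPr]
      simp only [map_add, map_mul, conj_ofReal, conj_I, conj_radialK_of_real a hω m r]
      push_cast
      ring
    rw [hval] at hF
    have hQF : ∀ y, Q y = (lam * (delta M a Λ y : ℂ) * (R y * conj (R y)) - P y * conj (P y)).re := by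
      intro y
      rw [hQ, mul_conj, mul_conj]
      simp only [sub_re, mul_re, ofReal_re, ofReal_im, mul_zero, sub_zero, hlam]
    have hQF' : Q = fun y => (lam * (delta M a Λ y : ℂ) * (R y * conj (R y)) - P y * conj (P y)).re :=
      funext hQF
    rw [hQF']
    simpa only [Function.comp_def, reCLM_apply, zero_re] using
      (reCLM.hasFDerivAt.comp_hasDerivAt r hF)
  /- ───── the event horizon `r₊`: `R = u^{z₁} f`, `z₁ = −(1/2 + B(r₊))`, `Re z₁ = −1/2` ───── -/
  set p₁ := rPlus M a Λ with hp₁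
  set d₁ : ℝ := deltaDeriv M a Λ p₁ with hd₁_def
  set z₁ : ℂ := -((((1 / 2 : ℝ)) : ℂ) + horizonB M a Λ ω m p₁) with hz₁
  have hz₁re : z₁.re = -(1 / 2) := by
    rw [hz₁, neg_re, add_re, ofReal_re, re_horizonB, hω]
    ring
  -- factorisation data at `p₁`
  set c₁ : ℝ := 1 - Λ / 3 * a ^ 2 - 2 * Λ * p₁ ^ 2 with hc₁
  set L₁f : ℝ → ℝ := fun r => c₁ - 4 * Λ / 3 * p₁ * (r - p₁) - Λ / 3 * (r - p₁) ^ 2 with hL₁f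
  set σ₁ : ℝ → ℝ := fun r => d₁ + (r - p₁) * L₁f r with hσ₁
  set σd₁ : ℝ → ℝ := fun r => c₁ - 8 * Λ / 3 * p₁ * (r - p₁) - Λ * (r - p₁) ^ 2 with hσd₁
  have hΔσ₁ : ∀ r, delta M a Λ r = (r - p₁) * σ₁ r := fun r => by
    rw [delta_taylor M a Λ p₁ r, hΔ1]
    simp only [hσ₁, hL₁f, hc₁, hd₁_def]
    ring
  have hDσ₁ : ∀ r, deltaDeriv M a Λ r = σ₁ r + (r - p₁) * σd₁ r := fun r => by
    simp only [hσ₁, hσd₁, hL₁f, hc₁, hd₁_def, deltaDeriv]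
    ring
  set Kp₁ : ℂ := radialK a ω m p₁ with hKp₁
  set ρ₁ : ℝ → ℂ := fun r => ω * ((r + p₁ : ℝ) : ℂ) * (d₁ : ℂ) - Kp₁ * (L₁f r : ℂ) with hρ₁
  have hKρ₁ : ∀ r, radialK a ω m r * (d₁ : ℂ) - Kp₁ * (σ₁ r : ℂ) = ((r - p₁ : ℝ) : ℂ) * ρ₁ r :=
    fun r => by
    simp only [hρ₁, hσ₁, hKp₁, radialK]
    push_cast
    ring
  have hB₁ : horizonB M a Λ ω m p₁ * (d₁ : ℂ) = I * (xi a Λ : ℂ) * Kp₁ := by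
    have hd' : (d₁ : ℂ) ≠ 0 := by exact_mod_cast hd1.ne'
    simp only [horizonB]
    rw [← hKp₁, ← hd₁_def]
    field_simp
  have hσ₁c : Continuous σ₁ := by rw [hσ₁, hL₁f]; fun_prop
  have hσd₁c : Continuous σd₁ := by rw [hσd₁]; fun_prop
  have hρ₁c : Continuous ρ₁ := by rw [hρ₁, hL₁f]; fun_prop
  have hσ₁p : σ₁ p₁ = d₁ := by simp [hσ₁]
  -- the regular factor `H₁` of `P` near `r₊`: `P = u^{z₁}·u·H₁`
  set H₁ : ℝ → ℂ := fun x => (σ₁ x : ℂ) * deriv f x +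
    (((σd₁ x / 2 : ℝ) : ℂ) + I * (xi a Λ : ℂ) * ρ₁ x / (d₁ : ℂ)) * f x with hH₁
  have hU₁o : IsOpen (Ioo (p₁ - ε₁) (p₁ + ε₁)) := isOpen_Ioo
  have hp₁U : p₁ ∈ Ioo (p₁ - ε₁) (p₁ + ε₁) := ⟨by linarith, by linarith⟩
  have hb₁ : p₁ < min (p₁ + ε₁) (rCosmo M a Λ) := lt_min (by linarith) h12
  have hJ₁U : Ioo p₁ (min (p₁ + ε₁) (rCosmo M a Λ)) ⊆ Ioo (p₁ - ε₁) (p₁ + ε₁) := fun x hx =>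
    ⟨by linarith [hx.1], lt_of_lt_of_le hx.2 (min_le_left _ _)⟩
  have hJ₁D : Ioo p₁ (min (p₁ + ε₁) (rCosmo M a Λ)) ⊆ Ioo (rPlus M a Λ) (rCosmo M a Λ) := fun x hx =>
    ⟨hx.1, lt_of_lt_of_le hx.2 (min_le_right _ _)⟩
  have hfd : DifferentiableOn ℝ f (Ioo (p₁ - ε₁) (p₁ + ε₁)) := hf.differentiableOn h0top
  have hfc : ContinuousAt f p₁ :=
    (hfd.continuousOn.continuousWithinAt hp₁U).continuousAt (hU₁o.mem_nhds hp₁U)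
  have hf'c : ContinuousAt (deriv f) p₁ :=
    ((hf.continuousOn_deriv_of_isOpen hU₁o h1top).continuousWithinAt hp₁U).continuousAt
      (hU₁o.mem_nhds hp₁U)
  -- the branch representation of `R` and `R'` on `J₁`
  have hRJ₁ : ∀ x ∈ Ioo p₁ (min (p₁ + ε₁) (rCosmo M a Λ)),
      R x = ((x - p₁ : ℝ) : ℂ) ^ z₁ * f x := by
    intro x hx
    have hx0 : (0 : ℝ) < x - p₁ := by linarith [hx.1]
    have hne : ((x - p₁ : ℝ) : ℂ) ≠ 0 := by exact_mod_cast hx0.ne'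
    have h := hRf x ⟨hx.1, lt_of_lt_of_le hx.2 (min_le_left _ _)⟩
    have hpow : ((x - p₁ : ℝ) : ℂ) ^ ((((1 / 2 : ℝ)) : ℂ) + horizonB M a Λ ω m p₁) ≠ 0 := by
      rw [Ne, cpow_eq_zero_iff, not_and_or]; exact Or.inl hne
    rw [hz₁, cpow_neg, ← h, mul_comm (R x) _, ← mul_assoc, inv_mul_cancel₀ hpow, one_mul]
  have hR'J₁ := deriv_eq_of_cpowBranch hU₁o isOpen_Ioo hJ₁U hf (u := fun x => x - p₁) (c := 1)
    (fun x => (hasDerivAt_id' x).sub_const _) (fun x hx => by simp only [sub_pos]; exact hx.1) z₁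
    (S := R) (S' := R') (fun x hx => (hode x (hJ₁D hx)).1) hRJ₁
  -- `P = u^{z₁}·(u·H₁)` on `J₁`
  have hPJ₁ : ∀ x ∈ Ioo p₁ (min (p₁ + ε₁) (rCosmo M a Λ)),
      P x = ((x - p₁ : ℝ) : ℂ) ^ z₁ * (((x - p₁ : ℝ) : ℂ) * H₁ x) := by
    intro x hx
    have hx0 : (0 : ℝ) < x - p₁ := by linarith [hx.1]
    have hne : ((x - p₁ : ℝ) : ℂ) ≠ 0 := by exact_mod_cast hx0.ne'
    have hd' : (d₁ : ℂ) ≠ 0 := by exact_mod_cast hd1.ne'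
    have e1 : ((x - p₁ : ℝ) : ℂ) ^ (z₁ - 1) = ((x - p₁ : ℝ) : ℂ) ^ z₁ / ((x - p₁ : ℝ) : ℂ) := by
      rw [cpow_sub _ _ hne, cpow_one]
    have hΔx : (delta M a Λ x : ℂ) = ((x - p₁ : ℝ) : ℂ) * (σ₁ x : ℂ) := by
      rw [hΔσ₁ x]; push_cast; ring
    have hDx : (((deltaDeriv M a Λ x / 2 : ℝ)) : ℂ) =
        ((σ₁ x : ℂ) + ((x - p₁ : ℝ) : ℂ) * (σd₁ x : ℂ)) / 2 := by
      rw [hDσ₁ x]; push_cast; ring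
    have hKx : radialK a ω m x = (((x - p₁ : ℝ) : ℂ) * ρ₁ x + Kp₁ * (σ₁ x : ℂ)) / (d₁ : ℂ) := by
      rw [eq_div_iff hd']
      linear_combination hKρ₁ x
    have hz₁' : z₁ = -(((1 / 2 : ℝ)) : ℂ) - I * (xi a Λ : ℂ) * Kp₁ / (d₁ : ℂ) := by
      rw [hz₁]
      have : horizonB M a Λ ω m p₁ = I * (xi a Λ : ℂ) * Kp₁ / (d₁ : ℂ) := by
        rw [eq_div_iff hd']; exact hB₁
      rw [this]; ring
    have hne' : (x : ℂ) - (p₁ : ℂ) ≠ 0 := by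
      have h := hne
      push_cast at h
      exact h
    rw [hP]
    simp only [hH₁]
    rw [hR'J₁ x hx, hRJ₁ x hx, e1, hΔx, hDx, hKx]
    rw [hz₁']
    push_cast
    field_simp
    ring
  -- `Q` on `J₁`: `Q = Re λ · σ₁|f|² − u|H₁|²`
  have hQJ₁ : ∀ x ∈ Ioo p₁ (min (p₁ + ε₁) (rCosmo M a Λ)),
      Q x = lam.re * σ₁ x * normSq (f x) - (x - p₁) * normSq (H₁ x) := by
    intro x hx
    have hx0 : (0 : ℝ) < x - p₁ := by linarith [hx.1]
    have hnpow : normSq (((x - p₁ : ℝ) : ℂ) ^ z₁) = (x - p₁)⁻¹ := by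
      rw [normSq_ofReal_cpow hx0, hz₁re]
      norm_num
      exact Real.rpow_neg_one (x - p₁)
    rw [hQ]
    simp only
    rw [hPJ₁ x hx, hRJ₁ x hx, map_mul, map_mul, map_mul, hnpow, normSq_ofReal, hΔσ₁ x]
    field_simp
  -- the limit of `Q` at `r₊`
  set Lp : ℝ := lam.re * d₁ * normSq (f p₁) with hLp
  have hlim₁ : Tendsto Q (𝓝[>] p₁) (𝓝 Lp) := by
    have hH₁c : ContinuousAt H₁ p₁ := by
      have h1 : ContinuousAt (fun x => (σ₁ x : ℂ)) p₁ :=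
        (continuous_ofReal.comp hσ₁c).continuousAt
      have h2 : ContinuousAt (fun x => (((σd₁ x / 2 : ℝ)) : ℂ)) p₁ :=
        (continuous_ofReal.comp (hσd₁c.div_const 2)).continuousAt
      have h3 : ContinuousAt (fun x => I * (xi a Λ : ℂ) * ρ₁ x / (d₁ : ℂ)) p₁ :=
        ((continuous_const.mul hρ₁c).div_const _).continuousAt
      simp only [hH₁]
      exact (h1.mul hf'c).add ((h2.add h3).mul hfc)
    have hmodel : Tendsto (fun x => lam.re * σ₁ x * normSq (f x) - (x - p₁) * normSq (H₁ x)) (𝓝 p₁)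
        (𝓝 (lam.re * σ₁ p₁ * normSq (f p₁) - (p₁ - p₁) * normSq (H₁ p₁))) := by
      have t1 : Tendsto σ₁ (𝓝 p₁) (𝓝 (σ₁ p₁)) := hσ₁c.continuousAt.tendsto
      have t2 : Tendsto (fun x => normSq (f x)) (𝓝 p₁) (𝓝 (normSq (f p₁))) :=
        (continuous_normSq.tendsto _).comp hfc.tendsto
      have t3 : Tendsto (fun x => normSq (H₁ x)) (𝓝 p₁) (𝓝 (normSq (H₁ p₁))) :=
        (continuous_normSq.tendsto _).comp hH₁c.tendsto
      have t4 : Tendsto (fun x : ℝ => x - p₁) (𝓝 p₁) (𝓝 (p₁ - p₁)) :=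
        ((continuous_id.sub continuous_const).tendsto p₁)
      exact ((t1.const_mul _).mul t2).sub (t4.mul t3)
    rw [hσ₁p, sub_self, zero_mul, sub_zero] at hmodel
    refine ((hmodel.mono_left nhdsWithin_le_nhds).congr' ?_)
    filter_upwards [Ioo_mem_nhdsGT hb₁] with x hx
    exact (hQJ₁ x hx).symm
  /- ───── the cosmological horizon `r_c`: `R = v^{w} g`, `w = B(r_c)`, `Re w = 0` ───── -/
  set p₂ := rCosmo M a Λ with hp₂
  set d₂ : ℝ := deltaDeriv M a Λ p₂ with hd₂_def
  set w : ℂ := horizonB M a Λ ω m p₂ with hw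
  have hwre : w.re = 0 := by
    rw [hw, re_horizonB, hω]; simp
  set c₂ : ℝ := 1 - Λ / 3 * a ^ 2 - 2 * Λ * p₂ ^ 2 with hc₂
  set σ₂ : ℝ → ℝ := fun r => d₂ + (r - p₂) * (c₂ - 4 * Λ / 3 * p₂ * (r - p₂) - Λ / 3 * (r - p₂) ^ 2)
    with hσ₂
  have hΔσ₂ : ∀ r, delta M a Λ r = (r - p₂) * σ₂ r := fun r => by
    rw [delta_taylor M a Λ p₂ r, hΔ2]
    simp only [hσ₂, hc₂, hd₂_def]
    ring
  have hσ₂c : Continuous σ₂ := by rw [hσ₂]; fun_prop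
  have hσ₂p : σ₂ p₂ = d₂ := by simp [hσ₂]
  have hB₂ : w * (d₂ : ℂ) = I * (xi a Λ : ℂ) * radialK a ω m p₂ := by
    have hd' : (d₂ : ℂ) ≠ 0 := by exact_mod_cast hd2.ne
    rw [hw]
    simp only [horizonB]
    rw [← hd₂_def]
    field_simp
  -- the regular factor `H₂` of `P` near `r_c`: `P = v^{w}·H₂`
  set H₂ : ℝ → ℂ := fun x => (delta M a Λ x : ℂ) * deriv g x +
    (w * (σ₂ x : ℂ) + ((deltaDeriv M a Λ x / 2 : ℝ) : ℂ) + I * (xi a Λ : ℂ) * radialK a ω m x) * g x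
    with hH₂
  have hU₂o : IsOpen (Ioo (p₂ - ε₂) (p₂ + ε₂)) := isOpen_Ioo
  have hp₂U : p₂ ∈ Ioo (p₂ - ε₂) (p₂ + ε₂) := ⟨by linarith, by linarith⟩
  have hb₂ : max (p₂ - ε₂) (rPlus M a Λ) < p₂ := max_lt (by linarith) h12
  have hJ₂U : Ioo (max (p₂ - ε₂) (rPlus M a Λ)) p₂ ⊆ Ioo (p₂ - ε₂) (p₂ + ε₂) := fun x hx =>
    ⟨lt_of_le_of_lt (le_max_left _ _) hx.1, by linarith [hx.2]⟩
  have hJ₂D : Ioo (max (p₂ - ε₂) (rPlus M a Λ)) p₂ ⊆ Ioo (rPlus M a Λ) (rCosmo M a Λ) := fun x hx =>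
    ⟨lt_of_le_of_lt (le_max_right _ _) hx.1, hx.2⟩
  have hgd : DifferentiableOn ℝ g (Ioo (p₂ - ε₂) (p₂ + ε₂)) := hg.differentiableOn h0top
  have hgc : ContinuousAt g p₂ :=
    (hgd.continuousOn.continuousWithinAt hp₂U).continuousAt (hU₂o.mem_nhds hp₂U)
  have hg'c : ContinuousAt (deriv g) p₂ :=
    ((hg.continuousOn_deriv_of_isOpen hU₂o h1top).continuousWithinAt hp₂U).continuousAt
      (hU₂o.mem_nhds hp₂U)
  have hRJ₂ : ∀ x ∈ Ioo (max (p₂ - ε₂) (rPlus M a Λ)) p₂,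
      R x = ((p₂ - x : ℝ) : ℂ) ^ w * g x := by
    intro x hx
    have hx0 : (0 : ℝ) < p₂ - x := by linarith [hx.2]
    have hne : ((p₂ - x : ℝ) : ℂ) ≠ 0 := by exact_mod_cast hx0.ne'
    have h := hRg x ⟨lt_of_le_of_lt (le_max_left _ _) hx.1, hx.2⟩
    have hpow : ((p₂ - x : ℝ) : ℂ) ^ w ≠ 0 := by
      rw [Ne, cpow_eq_zero_iff, not_and_or]; exact Or.inl hne
    rw [cpow_neg] at h
    rw [← h, mul_comm (R x) _, ← mul_assoc, mul_inv_cancel₀ hpow, one_mul]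
  have hR'J₂ := deriv_eq_of_cpowBranch hU₂o isOpen_Ioo hJ₂U hg (u := fun x => p₂ - x) (c := -1)
    (fun x => (hasDerivAt_id' x).const_sub _) (fun x hx => by simp only [sub_pos]; exact hx.2) w
    (S := R) (S' := R') (fun x hx => (hode x (hJ₂D hx)).1) hRJ₂
  have hPJ₂ : ∀ x ∈ Ioo (max (p₂ - ε₂) (rPlus M a Λ)) p₂,
      P x = ((p₂ - x : ℝ) : ℂ) ^ w * H₂ x := by
    intro x hx
    have hx0 : (0 : ℝ) < p₂ - x := by linarith [hx.2]
    have hne : ((p₂ - x : ℝ) : ℂ) ≠ 0 := by exact_mod_cast hx0.ne'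
    have e1 : ((p₂ - x : ℝ) : ℂ) ^ (w - 1) = ((p₂ - x : ℝ) : ℂ) ^ w / ((p₂ - x : ℝ) : ℂ) := by
      rw [cpow_sub _ _ hne, cpow_one]
    have hne' : (p₂ : ℂ) - (x : ℂ) ≠ 0 := by
      have h := hne
      push_cast at h
      exact h
    have hΔx : (delta M a Λ x : ℂ) = -((p₂ - x : ℝ) : ℂ) * (σ₂ x : ℂ) := by
      rw [hΔσ₂ x]; push_cast; ring
    rw [hP]
    simp only [hH₂]
    rw [hR'J₂ x hx, hRJ₂ x hx, e1, hΔx]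
    push_cast
    field_simp
    ring
  have hQJ₂ : ∀ x ∈ Ioo (max (p₂ - ε₂) (rPlus M a Λ)) p₂,
      Q x = lam.re * delta M a Λ x * normSq (g x) - normSq (H₂ x) := by
    intro x hx
    have hx0 : (0 : ℝ) < p₂ - x := by linarith [hx.2]
    have hnpow : normSq (((p₂ - x : ℝ) : ℂ) ^ w) = 1 := by
      rw [normSq_ofReal_cpow hx0, hwre, mul_zero, Real.rpow_zero]
    rw [hQ]
    simp only
    rw [hPJ₂ x hx, hRJ₂ x hx, map_mul, map_mul, hnpow, one_mul, one_mul]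
  set Lc : ℝ := -normSq ((w * (d₂ : ℂ) + ((d₂ / 2 : ℝ) : ℂ) + I * (xi a Λ : ℂ) * radialK a ω m p₂) *
    g p₂) with hLc
  have hlim₂ : Tendsto Q (𝓝[<] p₂) (𝓝 Lc) := by
    have hH₂c : ContinuousAt H₂ p₂ := by
      have hΔc' : Continuous fun x : ℝ => (delta M a Λ x : ℂ) := by unfold delta; fun_prop
      have hD'c : Continuous fun x : ℝ => ((deltaDeriv M a Λ x / 2 : ℝ) : ℂ) := by
        unfold deltaDeriv; fun_prop
      have hKc : Continuous fun x : ℝ => radialK a ω m x := by unfold radialK; fun_prop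
      have h1 : ContinuousAt (fun x => w * (σ₂ x : ℂ)) p₂ :=
        (continuous_const.mul (continuous_ofReal.comp hσ₂c)).continuousAt
      simp only [hH₂]
      exact (hΔc'.continuousAt.mul hg'c).add
        (((h1.add hD'c.continuousAt).add (continuous_const.mul hKc).continuousAt).mul hgc)
    have hH₂p : H₂ p₂ = (w * (d₂ : ℂ) + ((d₂ / 2 : ℝ) : ℂ) + I * (xi a Λ : ℂ) * radialK a ω m p₂) *
        g p₂ := by
      simp only [hH₂, hσ₂p, hΔ2, hd₂_def]
      push_cast
      ring
    have hmodel : Tendsto (fun x => lam.re * delta M a Λ x * normSq (g x) - normSq (H₂ x)) (𝓝 p₂)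
        (𝓝 (lam.re * delta M a Λ p₂ * normSq (g p₂) - normSq (H₂ p₂))) := by
      have hΔc' : Continuous fun x : ℝ => delta M a Λ x := by unfold delta; fun_prop
      have t1 : Tendsto (fun x => delta M a Λ x) (𝓝 p₂) (𝓝 (delta M a Λ p₂)) :=
        hΔc'.continuousAt.tendsto
      have t2 : Tendsto (fun x => normSq (g x)) (𝓝 p₂) (𝓝 (normSq (g p₂))) :=
        (continuous_normSq.tendsto _).comp hgc.tendsto
      have t3 : Tendsto (fun x => normSq (H₂ x)) (𝓝 p₂) (𝓝 (normSq (H₂ p₂))) :=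
        (continuous_normSq.tendsto _).comp hH₂c.tendsto
      exact ((t1.const_mul _).mul t2).sub t3
    rw [hΔ2, mul_zero, zero_mul, zero_sub, hH₂p] at hmodel
    refine ((hmodel.mono_left nhdsWithin_le_nhds).congr' ?_)
    filter_upwards [Ioo_mem_nhdsLT hb₂] with x hx
    exact (hQJ₂ x hx).symm
  /- ───── conservation: `Lp = Lc`, hence `g(r_c) = 0` ───── -/
  have hLeq : Lp = Lc := by
    obtain ⟨c, -, hc⟩ := exists_ratio_hasDerivAt_eq_ratio_slope' (f := Q)
      (f' := fun _ => (0 : ℝ)) h12 (g := id) (g' := fun _ => (1 : ℝ))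
      (lfa := Lp) (lga := rPlus M a Λ) (lfb := Lc) (lgb := rCosmo M a Λ)
      (fun x hx => hQd x hx) (fun x _ => hasDerivAt_id x) hlim₁
      ((continuous_id.tendsto _).mono_left nhdsWithin_le_nhds) hlim₂
      ((continuous_id.tendsto _).mono_left nhdsWithin_le_nhds)
    simp only [mul_zero, mul_one] at hc
    linarith
  have hcoef : w * (d₂ : ℂ) + ((d₂ / 2 : ℝ) : ℂ) + I * (xi a Λ : ℂ) * radialK a ω m p₂ ≠ 0 := by
    intro h0
    have hre := congrArg Complex.re h0
    simp only [add_re, mul_re, ofReal_re, ofReal_im, hwre, I_re, I_im, zero_mul, mul_zero, sub_zero,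
      im_radialK_of_real a hω m p₂, zero_re] at hre
    have : w.im * 0 = 0 := mul_zero _
    linarith [hd2]
  have hg0 : g p₂ = 0 := by
    have hX : 0 ≤ lam.re * d₁ * normSq (f p₁) :=
      mul_nonneg (mul_nonneg hcoer hd1.le) (normSq_nonneg _)
    have hY : 0 ≤ normSq ((w * (d₂ : ℂ) + ((d₂ / 2 : ℝ) : ℂ) + I * (xi a Λ : ℂ) * radialK a ω m p₂) *
        g p₂) := normSq_nonneg _
    have hY0 : normSq ((w * (d₂ : ℂ) + ((d₂ / 2 : ℝ) : ℂ) + I * (xi a Λ : ℂ) * radialK a ω m p₂) *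
        g p₂) = 0 := by
      rw [hLp, hLc] at hLeq
      linarith
    have h := Complex.normSq_eq_zero.1 hY0
    rcases mul_eq_zero.1 h with h | h
    · exact absurd h hcoef
    · exact h
  exact radial_eq_zero_of_cosmoAmplitude_eq_zero hsub' hωim (by norm_num) hR hε₂ hg hRg hg0

/-! ### `s = −1/2`: the mirror pair `(R, P₋)`, `P₋ = 𝒟₀R`, and its conservation law -/

/-- The spin-`−1/2` radial coefficient, regrouped: `V_{−1/2} = (Ξ²K² + (i/2)ΞKΔ_r')/Δ_r − iΞK' −`
`(1 − α) − λ` (the `r²` term of STU (3.7) vanishes at `s = −1/2`). [cite: SuzukiTakasugiUmetsu1998, (3.7)] -/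
theorem radialPotential_negHalf (M a Λ : ℝ) (ω : ℂ) (m : ℝ) (lam : ℂ) (r : ℝ) :
    radialPotential M a Λ (-(1 / 2)) ω m lam r =
      ((xi a Λ : ℂ) ^ 2 * radialK a ω m r ^ 2 +
            I / 2 * (xi a Λ : ℂ) * radialK a ω m r * (deltaDeriv M a Λ r : ℂ)) / (delta M a Λ r : ℂ) -
        I * (xi a Λ : ℂ) * (ω * (2 * (r : ℂ))) - ((1 - Λ / 3 * a ^ 2 : ℝ) : ℂ) - lam := by
  simp only [radialPotential, alpha]
  push_cast
  ring

/-- **The first-order structure at `s = −1/2`.** If `R` solves the spin-`(−1/2)` radial Teukolsky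
equation at `r`, then `P₋ := R' − (iΞK/Δ_r)R = 𝒟₀R` (Wu–Yan's operator `𝒟₀`) satisfies
`Δ_r P₋' = −(Δ_r'/2 + iΞK)P₋ + (λ + (1−α))R` at `r` — the spin-`−1/2` equation is
`Δ_r^{1/2}𝒟₀†Δ_r^{1/2}·𝒟₀ R = λ_{1/2} R` with Wu–Yan's `λ_{1/2} = λ + (1 − α)` ((A4) at `2s = 1`).
[cite: WuYan2004, Appendix A, (A4) and (A5)] -/
theorem hasDerivAt_tsPartner_negHalf {M a Λ : ℝ} {ω : ℂ} {m : ℝ} {lam : ℂ} {R R' R'' : ℝ → ℂ}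
    {r : ℝ} (hΔ : delta M a Λ r ≠ 0) (h1 : HasDerivAt R (R' r) r) (h2 : HasDerivAt R' (R'' r) r)
    (heq : (delta M a Λ r : ℂ) * R'' r + ((-(1 / 2) + 1 : ℝ) : ℂ) * (deltaDeriv M a Λ r : ℂ) * R' r +
      radialPotential M a Λ (-(1 / 2)) ω m lam r * R r = 0) :
    HasDerivAt (fun y => R' y - I * (xi a Λ : ℂ) * radialK a ω m y / (delta M a Λ y : ℂ) * R y)
      ((-((((deltaDeriv M a Λ r / 2 : ℝ)) : ℂ) + I * (xi a Λ : ℂ) * radialK a ω m r) *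
            (R' r - I * (xi a Λ : ℂ) * radialK a ω m r / (delta M a Λ r : ℂ) * R r) +
          (lam + ((1 - Λ / 3 * a ^ 2 : ℝ) : ℂ)) * R r) / (delta M a Λ r : ℂ)) r := by
  have hΔc : (delta M a Λ r : ℂ) ≠ 0 := by exact_mod_cast hΔ
  have hΔd : HasDerivAt (fun y => (delta M a Λ y : ℂ)) ((deltaDeriv M a Λ r : ℝ) : ℂ) r :=
    (hasDerivAt_delta M a Λ r).ofReal_comp
  have hKd := hasDerivAt_radialK a ω m r
  have hquot := ((hKd.const_mul (I * (xi a Λ : ℂ))).div hΔd hΔc).fun_mul h1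
  have hall := h2.fun_sub hquot
  simp only [Pi.div_apply] at hall
  refine hall.congr_deriv ?_
  have hR'' : R'' r = -(((-(1 / 2) + 1 : ℝ) : ℂ) * (deltaDeriv M a Λ r : ℂ) * R' r +
        radialPotential M a Λ (-(1 / 2)) ω m lam r * R r) / (delta M a Λ r : ℂ) := by
    rw [eq_div_iff hΔc]
    linear_combination heq
  rw [hR'', radialPotential_negHalf]
  push_cast
  field_simp
  linear_combination (-6 * (xi a Λ : ℂ) ^ 2 * radialK a ω m r ^ 2 * R r) * I_sq

/-- **CTdC Theorem 3.10, fermionic real-axis clause at `s = −1/2`, in its domain of validity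
(`ℭ_{1/2}(λ̄) ≥ 0`, i.e. `Re λ + (1 − α) ≥ 0` for the tree's `λ` at spin `−1/2`) — PROVED.** On
subextremal Kerr–de Sitter let `R` be a classical solution of the spin-`(−1/2)` radial Teukolsky
equation on `(r₊, r_c)` with REAL `ω` (any) and REAL `λ` with `Re λ + (1 − Λa²/3) ≥ 0`, ingoing at
`𝓗⁺` and outgoing at `𝓗⁺_c` (generic exponents). Then `R ≡ 0` on `(r₊, r_c)`. Mechanism: with
`P₋ = R' − (iΞK/Δ_r)R` (`hasDerivAt_tsPartner_negHalf`), `Q₋ = (λ + (1−α))|R|² − Δ_r|P₋|²` is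
constant; its limits are `−Δ_r'(r₊)|1/2 − 2B(r₊)|²|f(r₊)|² ≤ 0` at `r₊` and `(λ + (1−α))|g(r_c)|² ≥ 0`
at `r_c`, so `f(r₊) = 0` and `radial_eq_zero_of_eventAmplitude_eq_zero` concludes.
[cite: CasalsTeixeiradacosta2022, Theorem 3.10 (second bullet, |s| = 1/2) with Costa2019 Proposition 2.21] -/
theorem radial_negHalf_real_eq_zero_of_coercive {M a Λ : ℝ} {ω : ℂ} {m : ℝ} {lam : ℂ}
    (hsub : IsSubextremal M a Λ) (hω : ω.im = 0) (hlam : lam.im = 0)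
    (hcoer : 0 ≤ lam.re + (1 - alpha a Λ))
    {R : ℝ → ℂ} (hR : IsRadialTeukolskySolution M a Λ (-(1 / 2)) ω m lam R)
    (hin : IsIngoingAtEventHorizon M a Λ (-(1 / 2)) ω m R)
    (hout : IsOutgoingAtCosmoHorizon M a Λ ω m R) :
    ∀ r ∈ Ioo (rPlus M a Λ) (rCosmo M a Λ), R r = 0 := by
  have hd1 := deltaDeriv_rPlus_pos hsub
  have hd2 := deltaDeriv_rCosmo_neg hsub
  have hsub' := hsub
  obtain ⟨hM, hΛ, h01, h12, hΔ1, hΔ2, -, hΔpos, -⟩ := hsub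
  have hξ : 0 < xi a Λ := xi_pos hΛ.le a
  have hr₁ : 0 < rPlus M a Λ := lt_of_le_of_lt (rMinus_nonneg M a Λ) h01
  have hr₂ : 0 < rCosmo M a Λ := hr₁.trans h12
  have hωim : 0 ≤ ω.im := le_of_eq hω.symm
  have h1top : (1 : WithTop ℕ∞) ≤ ((⊤ : ℕ∞) : WithTop ℕ∞) := by exact_mod_cast le_top
  have h0top : ((⊤ : ℕ∞) : WithTop ℕ∞) ≠ 0 := by simp
  obtain ⟨R', R'', hode⟩ := id hR
  obtain ⟨ε₁, hε₁, f, hf, hRf⟩ := hin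
  obtain ⟨ε₂, hε₂, g, hg, hRg⟩ := hout
  -- the shifted constant `λ₊ = λ + (1 − α)` (Wu–Yan's `λ_{1/2}`), real
  obtain ⟨lamP, hlamP⟩ : ∃ lamP : ℂ, lamP = lam + ((1 - Λ / 3 * a ^ 2 : ℝ) : ℂ) := ⟨_, rfl⟩
  have hlamPim : lamP.im = 0 := by rw [hlamP, add_im, ofReal_im, hlam, add_zero]
  have hlamPre : lamP.re = lam.re + (1 - alpha a Λ) := by
    rw [hlamP, add_re, ofReal_re, alpha]
  have hlamPc : conj lamP = lamP := conj_eq_iff_im.2 hlamPim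
  -- the partner `P₋ = R' − (iΞK/Δ)R` and the conserved form `Q = Re λ₊ · |R|² − Δ|P₋|²`
  obtain ⟨P, hP⟩ : ∃ P : ℝ → ℂ, P = fun y => R' y -
      I * (xi a Λ : ℂ) * radialK a ω m y / (delta M a Λ y : ℂ) * R y := ⟨_, rfl⟩
  obtain ⟨Q, hQ⟩ : ∃ Q : ℝ → ℝ, Q = fun y => lamP.re * normSq (R y) - delta M a Λ y * normSq (P y) :=
    ⟨_, rfl⟩
  have hQd : ∀ r ∈ Ioo (rPlus M a Λ) (rCosmo M a Λ), HasDerivAt Q 0 r := by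
    intro r hr
    obtain ⟨h1, h2, heq⟩ := hode r hr
    have hΔne : delta M a Λ r ≠ 0 := (hΔpos r hr).ne'
    have hΔc : (delta M a Λ r : ℂ) ≠ 0 := by exact_mod_cast hΔne
    obtain ⟨cn, hcn⟩ : ∃ cn : ℂ, cn = -((((deltaDeriv M a Λ r / 2 : ℝ)) : ℂ) +
        I * (xi a Λ : ℂ) * radialK a ω m r) / (delta M a Λ r : ℂ) := ⟨_, rfl⟩
    obtain ⟨μ, hμ⟩ : ∃ μ : ℂ, μ = lamP / (delta M a Λ r : ℂ) := ⟨_, rfl⟩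
    have hPd : HasDerivAt P (cn * P r + μ * R r) r := by
      have h := hasDerivAt_tsPartner_negHalf (ω := ω) (m := m) (lam := lam) hΔne h1 h2 heq
      rw [hP, hcn, hμ, hlamP]
      refine h.congr_deriv ?_
      ring
    have hE1 : (delta M a Λ r : ℂ) * (cn + conj cn) = -((deltaDeriv M a Λ r : ℝ) : ℂ) := by
      rw [hcn]
      simp only [map_neg, map_div₀, map_add, map_mul, conj_ofReal, conj_I,
        conj_radialK_of_real a hω m r]
      push_cast
      field_simp
      ring
    have hE2 : (delta M a Λ r : ℂ) * μ = lamP := by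
      rw [hμ]
      field_simp
    have hμc : conj μ = μ := by
      rw [hμ, map_div₀, conj_ofReal, hlamPc]
    have hΔd : HasDerivAt (fun y => (delta M a Λ y : ℂ)) ((deltaDeriv M a Λ r : ℝ) : ℂ) r :=
      (hasDerivAt_delta M a Λ r).ofReal_comp
    have hRbar : HasDerivAt (fun y => conj (R y)) (conj (R' r)) r := by simpa using h1.star
    have hPbar : HasDerivAt (fun y => conj (P y)) (conj (cn * P r + μ * R r)) r := by
      simpa using hPd.star
    have hF : HasDerivAt (fun y => lamP * (R y * conj (R y)) - (delta M a Λ y : ℂ) * (P y * conj (P y)))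
        (lamP * (R' r * conj (R r) + R r * conj (R' r)) -
          (((deltaDeriv M a Λ r : ℝ) : ℂ) * (P r * conj (P r)) +
            (delta M a Λ r : ℂ) * ((cn * P r + μ * R r) * conj (P r) +
              P r * conj (cn * P r + μ * R r)))) r := by
      have hA := (h1.fun_mul hRbar).const_mul lamP
      have hB := hΔd.fun_mul (hPd.fun_mul hPbar)
      exact (hA.fun_sub hB).congr_deriv (by ring)
    have hval : lamP * (R' r * conj (R r) + R r * conj (R' r)) -
        (((deltaDeriv M a Λ r : ℝ) : ℂ) * (P r * conj (P r)) +
          (delta M a Λ r : ℂ) * ((cn * P r + μ * R r) * conj (P r) +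
            P r * conj (cn * P r + μ * R r))) = 0 := by
      have hT : R r * conj (P r) + P r * conj (R r) = R' r * conj (R r) + R r * conj (R' r) := by
        have hPr : P r = R' r - I * (xi a Λ : ℂ) * radialK a ω m r / (delta M a Λ r : ℂ) * R r := by
          rw [hP]
        rw [hPr]
        simp only [map_sub, map_mul, map_div₀, conj_ofReal, conj_I, conj_radialK_of_real a hω m r]
        ring
      rw [map_add, map_mul, map_mul, hμc]
      linear_combination (-(P r * conj (P r))) * hE1 + (-(R r * conj (P r) + P r * conj (R r))) * hE2 +
        (-lamP) * hT
    rw [hval] at hF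
    have hQF : ∀ y, Q y = (lamP * (R y * conj (R y)) - (delta M a Λ y : ℂ) * (P y * conj (P y))).re := by
      intro y
      rw [hQ, mul_conj, mul_conj]
      simp only [sub_re, mul_re, ofReal_re, ofReal_im, mul_zero, sub_zero, hlamPim]
    rw [show Q = _ from funext hQF]
    simpa only [Function.comp_def, reCLM_apply, zero_re] using
      (reCLM.hasFDerivAt.comp_hasDerivAt r hF)
  /- ───── the event horizon `r₊`: `R = u^{z₁} f`, `z₁ = 1/2 − B(r₊)`, `Re z₁ = 1/2` ───── -/
  set p₁ := rPlus M a Λ with hp₁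
  set d₁ : ℝ := deltaDeriv M a Λ p₁ with hd₁_def
  set B₁ : ℂ := horizonB M a Λ ω m p₁ with hB₁_def
  set z₁ : ℂ := -((((-(1 / 2) : ℝ)) : ℂ) + B₁) with hz₁
  have hB₁re : B₁.re = 0 := by rw [hB₁_def, re_horizonB, hω]; simp
  have hz₁re : z₁.re = 1 / 2 := by
    rw [hz₁, neg_re, add_re, ofReal_re, hB₁re]
    ring
  set c₁ : ℝ := 1 - Λ / 3 * a ^ 2 - 2 * Λ * p₁ ^ 2 with hc₁
  set σ₁ : ℝ → ℝ := fun r => d₁ + (r - p₁) * (c₁ - 4 * Λ / 3 * p₁ * (r - p₁) - Λ / 3 * (r - p₁) ^ 2)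
    with hσ₁
  have hΔσ₁ : ∀ r, delta M a Λ r = (r - p₁) * σ₁ r := fun r => by
    rw [delta_taylor M a Λ p₁ r, hΔ1]
    simp only [hσ₁, hc₁, hd₁_def]
    ring
  have hσ₁c : Continuous σ₁ := by rw [hσ₁]; fun_prop
  have hσ₁p : σ₁ p₁ = d₁ := by simp [hσ₁]
  have hB₁d : B₁ * (d₁ : ℂ) = I * (xi a Λ : ℂ) * radialK a ω m p₁ := by
    have hd' : (d₁ : ℂ) ≠ 0 := by exact_mod_cast hd1.ne'
    rw [hB₁_def]
    simp only [horizonB]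
    rw [← hd₁_def]
    field_simp
  -- `σ₁ ≠ 0` near `p₁`
  have hevσ : ∀ᶠ r in 𝓝 p₁, σ₁ r ≠ 0 := by
    have h := hσ₁c.continuousAt (x := p₁)
    rw [ContinuousAt, hσ₁p] at h
    exact h.eventually_ne hd1.ne'
  obtain ⟨δ₁, hδ₁, hδσ⟩ := Metric.eventually_nhds_iff.1 hevσ
  have hσ₁ne : ∀ r ∈ Ioo (p₁ - δ₁) (p₁ + δ₁), σ₁ r ≠ 0 := fun r hr =>
    hδσ (by rw [Real.dist_eq, abs_lt]; constructor <;> linarith [hr.1, hr.2])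
  -- the regular factor `G₁` of `P₋` near `r₊`: `P₋ = u^{z₁}·G₁/u`
  set G₁ : ℝ → ℂ := fun x => ((x - p₁ : ℝ) : ℂ) * deriv f x +
    (z₁ - I * (xi a Λ : ℂ) * radialK a ω m x / (σ₁ x : ℂ)) * f x with hG₁
  set e₁ : ℝ := min ε₁ δ₁ with he₁
  have he₁pos : 0 < e₁ := lt_min hε₁ hδ₁
  have hU₁o : IsOpen (Ioo (p₁ - ε₁) (p₁ + ε₁)) := isOpen_Ioo
  have hp₁U : p₁ ∈ Ioo (p₁ - ε₁) (p₁ + ε₁) := ⟨by linarith, by linarith⟩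
  have hb₁ : p₁ < min (p₁ + e₁) (rCosmo M a Λ) := lt_min (by linarith) h12
  have hJ₁U : Ioo p₁ (min (p₁ + e₁) (rCosmo M a Λ)) ⊆ Ioo (p₁ - ε₁) (p₁ + ε₁) := fun x hx =>
    ⟨by linarith [hx.1], by
      have := lt_of_lt_of_le hx.2 (min_le_left _ _); linarith [min_le_left ε₁ δ₁]⟩
  have hJ₁D : Ioo p₁ (min (p₁ + e₁) (rCosmo M a Λ)) ⊆ Ioo (rPlus M a Λ) (rCosmo M a Λ) := fun x hx =>
    ⟨hx.1, lt_of_lt_of_le hx.2 (min_le_right _ _)⟩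
  have hJ₁σ : ∀ x ∈ Ioo p₁ (min (p₁ + e₁) (rCosmo M a Λ)), σ₁ x ≠ 0 := fun x hx =>
    hσ₁ne x ⟨by linarith [hx.1], by
      have := lt_of_lt_of_le hx.2 (min_le_left _ _); linarith [min_le_right ε₁ δ₁]⟩
  have hfd : DifferentiableOn ℝ f (Ioo (p₁ - ε₁) (p₁ + ε₁)) := hf.differentiableOn h0top
  have hfc : ContinuousAt f p₁ :=
    (hfd.continuousOn.continuousWithinAt hp₁U).continuousAt (hU₁o.mem_nhds hp₁U)
  have hf'c : ContinuousAt (deriv f) p₁ :=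
    ((hf.continuousOn_deriv_of_isOpen hU₁o h1top).continuousWithinAt hp₁U).continuousAt
      (hU₁o.mem_nhds hp₁U)
  have hRJ₁ : ∀ x ∈ Ioo p₁ (min (p₁ + e₁) (rCosmo M a Λ)),
      R x = ((x - p₁ : ℝ) : ℂ) ^ z₁ * f x := by
    intro x hx
    have hx0 : (0 : ℝ) < x - p₁ := by linarith [hx.1]
    have hne : ((x - p₁ : ℝ) : ℂ) ≠ 0 := by exact_mod_cast hx0.ne'
    have h := hRf x ⟨hx.1, by
      have := lt_of_lt_of_le hx.2 (min_le_left _ _); linarith [min_le_left ε₁ δ₁]⟩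
    have hpow : ((x - p₁ : ℝ) : ℂ) ^ ((((-(1 / 2) : ℝ)) : ℂ) + B₁) ≠ 0 := by
      rw [Ne, cpow_eq_zero_iff, not_and_or]; exact Or.inl hne
    rw [hz₁, cpow_neg, ← h, mul_comm (R x) _, ← mul_assoc, inv_mul_cancel₀ hpow, one_mul]
  have hR'J₁ := deriv_eq_of_cpowBranch hU₁o isOpen_Ioo hJ₁U hf (u := fun x => x - p₁) (c := 1)
    (fun x => (hasDerivAt_id' x).sub_const _) (fun x hx => by simp only [sub_pos]; exact hx.1) z₁
    (S := R) (S' := R') (fun x hx => (hode x (hJ₁D hx)).1) hRJ₁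
  have hPJ₁ : ∀ x ∈ Ioo p₁ (min (p₁ + e₁) (rCosmo M a Λ)),
      P x = ((x - p₁ : ℝ) : ℂ) ^ z₁ * (G₁ x / ((x - p₁ : ℝ) : ℂ)) := by
    intro x hx
    have hx0 : (0 : ℝ) < x - p₁ := by linarith [hx.1]
    have hne : ((x - p₁ : ℝ) : ℂ) ≠ 0 := by exact_mod_cast hx0.ne'
    have hne' : (x : ℂ) - (p₁ : ℂ) ≠ 0 := by
      have h := hne
      push_cast at h
      exact h
    have hσx : (σ₁ x : ℂ) ≠ 0 := by exact_mod_cast hJ₁σ x hx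
    have e1 : ((x - p₁ : ℝ) : ℂ) ^ (z₁ - 1) = ((x - p₁ : ℝ) : ℂ) ^ z₁ / ((x - p₁ : ℝ) : ℂ) := by
      rw [cpow_sub _ _ hne, cpow_one]
    have hΔx : (delta M a Λ x : ℂ) = ((x - p₁ : ℝ) : ℂ) * (σ₁ x : ℂ) := by
      rw [hΔσ₁ x]; push_cast; ring
    rw [hP]
    simp only [hG₁]
    rw [hR'J₁ x hx, hRJ₁ x hx, e1, hΔx]
    push_cast
    field_simp
    ring
  have hQJ₁ : ∀ x ∈ Ioo p₁ (min (p₁ + e₁) (rCosmo M a Λ)),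
      Q x = lamP.re * ((x - p₁) * normSq (f x)) - σ₁ x * normSq (G₁ x) := by
    intro x hx
    have hx0 : (0 : ℝ) < x - p₁ := by linarith [hx.1]
    have hnpow : normSq (((x - p₁ : ℝ) : ℂ) ^ z₁) = x - p₁ := by
      rw [normSq_ofReal_cpow hx0, hz₁re]
      norm_num
    rw [hQ]
    simp only
    rw [hPJ₁ x hx, hRJ₁ x hx, map_mul, map_mul, map_div₀, hnpow, normSq_ofReal, hΔσ₁ x]
    field_simp
  set Lp : ℝ := -(d₁ * normSq ((z₁ - B₁) * f p₁)) with hLp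
  have hlim₁ : Tendsto Q (𝓝[>] p₁) (𝓝 Lp) := by
    have hKc : Continuous fun x : ℝ => radialK a ω m x := by unfold radialK; fun_prop
    have hG₁c : ContinuousAt G₁ p₁ := by
      have h1 : ContinuousAt (fun x : ℝ => ((x - p₁ : ℝ) : ℂ)) p₁ := by fun_prop
      have h2 : ContinuousAt (fun x => z₁ - I * (xi a Λ : ℂ) * radialK a ω m x / (σ₁ x : ℂ)) p₁ := by
        have hσ' : (σ₁ p₁ : ℂ) ≠ 0 := by rw [hσ₁p]; exact_mod_cast hd1.ne'
        exact continuousAt_const.sub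
          (((continuous_const.mul hKc).continuousAt).div
            (continuous_ofReal.comp hσ₁c).continuousAt hσ')
      simp only [hG₁]
      exact (h1.mul hf'c).add (h2.mul hfc)
    have hG₁p : G₁ p₁ = (z₁ - B₁) * f p₁ := by
      have hd' : (d₁ : ℂ) ≠ 0 := by exact_mod_cast hd1.ne'
      have hBeq : I * (xi a Λ : ℂ) * radialK a ω m p₁ / (d₁ : ℂ) = B₁ := by
        rw [div_eq_iff hd', hB₁d]
      simp only [hG₁, hσ₁p, sub_self]
      rw [hBeq]
      push_cast
      ring
    have hmodel : Tendsto (fun x => lamP.re * ((x - p₁) * normSq (f x)) - σ₁ x * normSq (G₁ x))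
        (𝓝 p₁) (𝓝 (lamP.re * ((p₁ - p₁) * normSq (f p₁)) - σ₁ p₁ * normSq (G₁ p₁))) := by
      have t1 : Tendsto σ₁ (𝓝 p₁) (𝓝 (σ₁ p₁)) := hσ₁c.continuousAt.tendsto
      have t2 : Tendsto (fun x => normSq (f x)) (𝓝 p₁) (𝓝 (normSq (f p₁))) :=
        (continuous_normSq.tendsto _).comp hfc.tendsto
      have t3 : Tendsto (fun x => normSq (G₁ x)) (𝓝 p₁) (𝓝 (normSq (G₁ p₁))) :=
        (continuous_normSq.tendsto _).comp hG₁c.tendsto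
      have t4 : Tendsto (fun x : ℝ => x - p₁) (𝓝 p₁) (𝓝 (p₁ - p₁)) :=
        ((continuous_id.sub continuous_const).tendsto p₁)
      exact ((t4.mul t2).const_mul _).sub (t1.mul t3)
    rw [hσ₁p, sub_self, zero_mul, mul_zero, zero_sub, hG₁p] at hmodel
    refine ((hmodel.mono_left nhdsWithin_le_nhds).congr' ?_)
    filter_upwards [Ioo_mem_nhdsGT hb₁] with x hx
    exact (hQJ₁ x hx).symm
  /- ───── the cosmological horizon `r_c`: `R = v^{w} g`, `w = B(r_c)`, `Re w = 0` ───── -/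
  set p₂ := rCosmo M a Λ with hp₂
  set d₂ : ℝ := deltaDeriv M a Λ p₂ with hd₂_def
  set w : ℂ := horizonB M a Λ ω m p₂ with hw
  have hwre : w.re = 0 := by
    rw [hw, re_horizonB, hω]; simp
  set c₂ : ℝ := 1 - Λ / 3 * a ^ 2 - 2 * Λ * p₂ ^ 2 with hc₂
  set L₂f : ℝ → ℝ := fun r => c₂ - 4 * Λ / 3 * p₂ * (r - p₂) - Λ / 3 * (r - p₂) ^ 2 with hL₂f
  set σ₂ : ℝ → ℝ := fun r => d₂ + (r - p₂) * L₂f r with hσ₂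
  have hΔσ₂ : ∀ r, delta M a Λ r = (r - p₂) * σ₂ r := fun r => by
    rw [delta_taylor M a Λ p₂ r, hΔ2]
    simp only [hσ₂, hL₂f, hc₂, hd₂_def]
    ring
  set Kp₂ : ℂ := radialK a ω m p₂ with hKp₂
  set ρ₂ : ℝ → ℂ := fun r => ω * ((r + p₂ : ℝ) : ℂ) * (d₂ : ℂ) - Kp₂ * (L₂f r : ℂ) with hρ₂
  have hKρ₂ : ∀ r, radialK a ω m r * (d₂ : ℂ) - Kp₂ * (σ₂ r : ℂ) = ((r - p₂ : ℝ) : ℂ) * ρ₂ r :=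
    fun r => by
    simp only [hρ₂, hσ₂, hKp₂, radialK]
    push_cast
    ring
  have hσ₂c : Continuous σ₂ := by rw [hσ₂, hL₂f]; fun_prop
  have hρ₂c : Continuous ρ₂ := by rw [hρ₂, hL₂f]; fun_prop
  have hσ₂p : σ₂ p₂ = d₂ := by simp [hσ₂]
  have hB₂ : w * (d₂ : ℂ) = I * (xi a Λ : ℂ) * Kp₂ := by
    have hd' : (d₂ : ℂ) ≠ 0 := by exact_mod_cast hd2.ne
    rw [hw]
    simp only [horizonB]
    rw [← hKp₂, ← hd₂_def]
    field_simp
  have hevσ₂ : ∀ᶠ r in 𝓝 p₂, σ₂ r ≠ 0 := by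
    have h := hσ₂c.continuousAt (x := p₂)
    rw [ContinuousAt, hσ₂p] at h
    exact h.eventually_ne hd2.ne
  obtain ⟨δ₂, hδ₂, hδσ₂⟩ := Metric.eventually_nhds_iff.1 hevσ₂
  have hσ₂ne : ∀ r ∈ Ioo (p₂ - δ₂) (p₂ + δ₂), σ₂ r ≠ 0 := fun r hr =>
    hδσ₂ (by rw [Real.dist_eq, abs_lt]; constructor <;> linarith [hr.1, hr.2])
  -- the regular factor `G₂` of `P₋` near `r_c`: `P₋ = v^{w}·G₂`
  set G₂ : ℝ → ℂ := fun x => deriv g x -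
    I * (xi a Λ : ℂ) * ρ₂ x / ((σ₂ x : ℂ) * (d₂ : ℂ)) * g x with hG₂
  set e₂ : ℝ := min ε₂ δ₂ with he₂
  have he₂pos : 0 < e₂ := lt_min hε₂ hδ₂
  have hU₂o : IsOpen (Ioo (p₂ - ε₂) (p₂ + ε₂)) := isOpen_Ioo
  have hp₂U : p₂ ∈ Ioo (p₂ - ε₂) (p₂ + ε₂) := ⟨by linarith, by linarith⟩
  have hb₂ : max (p₂ - e₂) (rPlus M a Λ) < p₂ := max_lt (by linarith) h12
  have hJ₂U : Ioo (max (p₂ - e₂) (rPlus M a Λ)) p₂ ⊆ Ioo (p₂ - ε₂) (p₂ + ε₂) := fun x hx =>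
    ⟨by have := lt_of_le_of_lt (le_max_left _ _) hx.1; linarith [min_le_left ε₂ δ₂],
      by linarith [hx.2]⟩
  have hJ₂D : Ioo (max (p₂ - e₂) (rPlus M a Λ)) p₂ ⊆ Ioo (rPlus M a Λ) (rCosmo M a Λ) := fun x hx =>
    ⟨lt_of_le_of_lt (le_max_right _ _) hx.1, hx.2⟩
  have hJ₂σ : ∀ x ∈ Ioo (max (p₂ - e₂) (rPlus M a Λ)) p₂, σ₂ x ≠ 0 := fun x hx =>
    hσ₂ne x ⟨by have := lt_of_le_of_lt (le_max_left _ _) hx.1; linarith [min_le_right ε₂ δ₂],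
      by linarith [hx.2]⟩
  have hgd : DifferentiableOn ℝ g (Ioo (p₂ - ε₂) (p₂ + ε₂)) := hg.differentiableOn h0top
  have hgc : ContinuousAt g p₂ :=
    (hgd.continuousOn.continuousWithinAt hp₂U).continuousAt (hU₂o.mem_nhds hp₂U)
  have hg'c : ContinuousAt (deriv g) p₂ :=
    ((hg.continuousOn_deriv_of_isOpen hU₂o h1top).continuousWithinAt hp₂U).continuousAt
      (hU₂o.mem_nhds hp₂U)
  have hRJ₂ : ∀ x ∈ Ioo (max (p₂ - e₂) (rPlus M a Λ)) p₂,
      R x = ((p₂ - x : ℝ) : ℂ) ^ w * g x := by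
    intro x hx
    have hx0 : (0 : ℝ) < p₂ - x := by linarith [hx.2]
    have hne : ((p₂ - x : ℝ) : ℂ) ≠ 0 := by exact_mod_cast hx0.ne'
    have h := hRg x ⟨by have := lt_of_le_of_lt (le_max_left _ _) hx.1; linarith [min_le_left ε₂ δ₂],
      hx.2⟩
    have hpow : ((p₂ - x : ℝ) : ℂ) ^ w ≠ 0 := by
      rw [Ne, cpow_eq_zero_iff, not_and_or]; exact Or.inl hne
    rw [cpow_neg] at h
    rw [← h, mul_comm (R x) _, ← mul_assoc, mul_inv_cancel₀ hpow, one_mul]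
  have hR'J₂ := deriv_eq_of_cpowBranch hU₂o isOpen_Ioo hJ₂U hg (u := fun x => p₂ - x) (c := -1)
    (fun x => (hasDerivAt_id' x).const_sub _) (fun x hx => by simp only [sub_pos]; exact hx.2) w
    (S := R) (S' := R') (fun x hx => (hode x (hJ₂D hx)).1) hRJ₂
  have hPJ₂ : ∀ x ∈ Ioo (max (p₂ - e₂) (rPlus M a Λ)) p₂,
      P x = ((p₂ - x : ℝ) : ℂ) ^ w * G₂ x := by
    intro x hx
    have hx0 : (0 : ℝ) < p₂ - x := by linarith [hx.2]
    have hne : ((p₂ - x : ℝ) : ℂ) ≠ 0 := by exact_mod_cast hx0.ne'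
    have hne' : (p₂ : ℂ) - (x : ℂ) ≠ 0 := by
      have h := hne
      push_cast at h
      exact h
    have hσx : (σ₂ x : ℂ) ≠ 0 := by exact_mod_cast hJ₂σ x hx
    have hd' : (d₂ : ℂ) ≠ 0 := by exact_mod_cast hd2.ne
    have e1 : ((p₂ - x : ℝ) : ℂ) ^ (w - 1) = ((p₂ - x : ℝ) : ℂ) ^ w / ((p₂ - x : ℝ) : ℂ) := by
      rw [cpow_sub _ _ hne, cpow_one]
    have hΔx : (delta M a Λ x : ℂ) = -((p₂ - x : ℝ) : ℂ) * (σ₂ x : ℂ) := by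
      rw [hΔσ₂ x]; push_cast; ring
    have hKx : radialK a ω m x = (-((p₂ - x : ℝ) : ℂ) * ρ₂ x + Kp₂ * (σ₂ x : ℂ)) / (d₂ : ℂ) := by
      rw [eq_div_iff hd']
      have h := hKρ₂ x
      push_cast at h ⊢
      linear_combination h
    have hw' : w = I * (xi a Λ : ℂ) * Kp₂ / (d₂ : ℂ) := by
      rw [eq_div_iff hd']; exact hB₂
    rw [hP]
    simp only [hG₂]
    rw [hR'J₂ x hx, hRJ₂ x hx, e1, hΔx, hKx]
    rw [hw']
    push_cast
    field_simp
    ring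
  have hQJ₂ : ∀ x ∈ Ioo (max (p₂ - e₂) (rPlus M a Λ)) p₂,
      Q x = lamP.re * normSq (g x) - delta M a Λ x * normSq (G₂ x) := by
    intro x hx
    have hx0 : (0 : ℝ) < p₂ - x := by linarith [hx.2]
    have hnpow : normSq (((p₂ - x : ℝ) : ℂ) ^ w) = 1 := by
      rw [normSq_ofReal_cpow hx0, hwre, mul_zero, Real.rpow_zero]
    rw [hQ]
    simp only
    rw [hPJ₂ x hx, hRJ₂ x hx, map_mul, map_mul, hnpow, one_mul, one_mul]
  set Lc : ℝ := lamP.re * normSq (g p₂) with hLc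
  have hlim₂ : Tendsto Q (𝓝[<] p₂) (𝓝 Lc) := by
    have hG₂c : ContinuousAt G₂ p₂ := by
      have hσ' : (σ₂ p₂ : ℂ) * (d₂ : ℂ) ≠ 0 := by
        rw [hσ₂p]; exact mul_ne_zero (by exact_mod_cast hd2.ne) (by exact_mod_cast hd2.ne)
      have h2 : ContinuousAt (fun x => I * (xi a Λ : ℂ) * ρ₂ x / ((σ₂ x : ℂ) * (d₂ : ℂ))) p₂ :=
        ((continuous_const.mul hρ₂c).continuousAt).div
          (((continuous_ofReal.comp hσ₂c).mul continuous_const).continuousAt) hσ'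
      simp only [hG₂]
      exact hg'c.sub (h2.mul hgc)
    have hmodel : Tendsto (fun x => lamP.re * normSq (g x) - delta M a Λ x * normSq (G₂ x)) (𝓝 p₂)
        (𝓝 (lamP.re * normSq (g p₂) - delta M a Λ p₂ * normSq (G₂ p₂))) := by
      have hΔc' : Continuous fun x : ℝ => delta M a Λ x := by unfold delta; fun_prop
      have t1 : Tendsto (fun x => delta M a Λ x) (𝓝 p₂) (𝓝 (delta M a Λ p₂)) :=
        hΔc'.continuousAt.tendsto
      have t2 : Tendsto (fun x => normSq (g x)) (𝓝 p₂) (𝓝 (normSq (g p₂))) :=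
        (continuous_normSq.tendsto _).comp hgc.tendsto
      have t3 : Tendsto (fun x => normSq (G₂ x)) (𝓝 p₂) (𝓝 (normSq (G₂ p₂))) :=
        (continuous_normSq.tendsto _).comp hG₂c.tendsto
      exact (t2.const_mul _).sub (t1.mul t3)
    rw [hΔ2, zero_mul, sub_zero] at hmodel
    refine ((hmodel.mono_left nhdsWithin_le_nhds).congr' ?_)
    filter_upwards [Ioo_mem_nhdsLT hb₂] with x hx
    exact (hQJ₂ x hx).symm
  /- ───── conservation: `Lp = Lc`, hence `f(r₊) = 0` ───── -/
  have hLeq : Lp = Lc := by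
    obtain ⟨c, -, hc⟩ := exists_ratio_hasDerivAt_eq_ratio_slope' (f := Q)
      (f' := fun _ => (0 : ℝ)) h12 (g := id) (g' := fun _ => (1 : ℝ))
      (lfa := Lp) (lga := rPlus M a Λ) (lfb := Lc) (lgb := rCosmo M a Λ)
      (fun x hx => hQd x hx) (fun x _ => hasDerivAt_id x) hlim₁
      ((continuous_id.tendsto _).mono_left nhdsWithin_le_nhds) hlim₂
      ((continuous_id.tendsto _).mono_left nhdsWithin_le_nhds)
    simp only [mul_zero, mul_one] at hc
    linarith
  have hcoef : z₁ - B₁ ≠ 0 := by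
    intro h0
    have hre := congrArg Complex.re h0
    rw [sub_re, hz₁re, hB₁re, zero_re] at hre
    norm_num at hre
  have hf0 : f p₁ = 0 := by
    have hX : 0 ≤ lamP.re * normSq (g p₂) := by
      rw [hlamPre]; exact mul_nonneg hcoer (normSq_nonneg _)
    have hY : 0 ≤ normSq ((z₁ - B₁) * f p₁) := normSq_nonneg _
    have hY0 : normSq ((z₁ - B₁) * f p₁) = 0 := by
      rw [hLp, hLc] at hLeq
      by_contra hN
      have hpos : 0 < normSq ((z₁ - B₁) * f p₁) := lt_of_le_of_ne hY (Ne.symm hN)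
      have := mul_pos hd1 hpos
      linarith
    have h := Complex.normSq_eq_zero.1 hY0
    rcases mul_eq_zero.1 h with h | h
    · exact absurd h hcoef
    · exact h
  exact radial_eq_zero_of_eventAmplitude_eq_zero hsub' hωim (by norm_num) hR hε₁ hf hRf hf0

/-! ### Both signs, with CTdC's binder `Im λ̄ = 0` and the clause `FermionicTSCoercive` -/

/-- At a real frequency CTdC's `λ̄` and the tree's `λ` have the same imaginary part (the shift
`−s(1−α) + Ξ²(2amω − a²ω²)` is real). [cite: CasalsTeixeiradacosta2022, (3.8)] -/
theorem im_lambdaBar_of_real (a Λ s : ℝ) {ω : ℂ} (hω : ω.im = 0) (m : ℝ) (lam : ℂ) :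
    (lambdaBar a Λ s ω m lam).im = lam.im := by
  have hωr : ω = ((ω.re : ℝ) : ℂ) := Complex.ext (by simp) (by simp [hω])
  rw [hωr, lambdaBar]
  have h : (xi a Λ : ℂ) ^ 2 * (2 * (a : ℂ) * (m : ℂ) * ((ω.re : ℝ) : ℂ) -
      (a : ℂ) ^ 2 * ((ω.re : ℝ) : ℂ) ^ 2) =
      (((xi a Λ) ^ 2 * (2 * a * m * ω.re - a ^ 2 * ω.re ^ 2) : ℝ) : ℂ) := by
    push_cast
    ring
  rw [h]
  simp only [add_im, sub_im, ofReal_im, sub_zero, add_zero]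

/-- **CTdC Theorem 3.10, fermionic real-axis clause `|s| = 1/2`, in the Teukolsky–Starobinsky-coercive
region — PROVED (both signs of the spin).** On subextremal Kerr–de Sitter: `Im ω = 0`, `Im λ̄ = 0`,
`FermionicTSCoercive M a Λ s ω m λ` (`2|s| = 1 ∧ ℭ_{1/2}(λ̄) ≥ 0`) ⟹ every classical radial Teukolsky
solution on `(r₊, r_c)` ingoing at `𝓗⁺` and outgoing at `𝓗⁺_c` vanishes identically. No condition on
`ω ≠ 0`, on `m`, on `a`, and no superradiant-window condition.
[cite: CasalsTeixeiradacosta2022, Theorem 3.10 (second bullet, |s| = 1/2) with Costa2019 Proposition 2.21] -/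
theorem radial_real_eq_zero_of_fermionicTSCoercive {M a Λ s : ℝ} {ω : ℂ} {m : ℝ} {lam : ℂ}
    (hsub : IsSubextremal M a Λ) (hω : ω.im = 0) (hlamBar : (lambdaBar a Λ s ω m lam).im = 0)
    (hF : FermionicTSCoercive M a Λ s ω m lam) {R : ℝ → ℂ}
    (hR : IsRadialTeukolskySolution M a Λ s ω m lam R) (hin : IsIngoingAtEventHorizon M a Λ s ω m R)
    (hout : IsOutgoingAtCosmoHorizon M a Λ ω m R) :
    ∀ r ∈ Ioo (rPlus M a Λ) (rCosmo M a Λ), R r = 0 := by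
  have hlam : lam.im = 0 := by rw [← im_lambdaBar_of_real a Λ s hω m lam]; exact hlamBar
  rcases hF.eq_half_or with hs | hs
  · subst hs
    exact radial_half_real_eq_zero_of_coercive hsub hω hlam
      ((fermionicTSCoercive_half_iff M a Λ ω m lam).1 hF) hR hin hout
  · subst hs
    exact radial_negHalf_real_eq_zero_of_coercive hsub hω hlam
      ((fermionicTSCoercive_neg_half_iff M a Λ ω m lam).1 hF) hR hin hout

end Literature.Geometry.Lorentzian.KerrDeSitter

end
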